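import Literature.Probability.Percolation.SusceptibilityGammaOne
import Literature.Probability.Percolation.CriticalContinuity
import HarnessLib

/-!
# Hutchcroft's `γ ≤ δ − 1` (2020): a critical volume tail bounds the subcritical susceptibility, on `ℤ^d`

Topic `Probability/Percolation`; namespace `Literature.Probability.Percolation`.  A NAMED FACT (`def … : Prop`, no proof
claimed), vendored by the PAPER-2 power-law seat (`prim-quant-arm-3`, gen 3) for the converse recorded after the quantitative
paper's Question q:chi: with the two-box volume exponent of
`Summits/…/PercNearOneGluingNoHeavyQuantHyperscalingTransfers.lean` it turns a critical one-arm power law with exponent `c > d/4`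
into the subcritical susceptibility input `γ' < 2` of `Quant.SubcriticalGammaLtTwo`
(`Summits/…/PercNearOneGluingNoHeavyQuantGammaOfOneArm.lean`).

## Source (read on the held text `paper:arxiv-1901.10363`, arXiv page numbers)

T. Hutchcroft, *New critical exponent inequalities for percolation and the random cluster model*, Probab. Math. Phys. 1
(2020) 147–165, arXiv:1901.10363 [Hutchcroft2020], §1 pp. 4–5:

* (p. 4) "`E_p[|K|] ≈ (p_c − p)^{−γ}` as `p ↑ p_c`", "`P_{p_c}(|K| ≥ n) ≈ n^{−1/δ}`"; `K` = "the cluster of some arbitrarily chosen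
  vertex"; (p. 5) "The first of these theorems relates the distribution of the volume of a critical cluster to the distribution of
  the volume of a subcritical cluster. It implies the critical exponent inequalities `γ ≤ δ − 1` and `Δ ≤ δ`."
* **Theorem 1.1.** "Let `G` be an infinite, connected, locally finite transitive graph, and suppose that there exist constants `C > 0`
  and `δ > 1` such that `P_{p_c}(|K| ≥ n) ≤ C n^{−1/δ}` for every `n ≥ 1`. Then the following hold:
  • There exist positive constants `c` and `C'` such that `P_p(|K| ≥ n) ≤ C' n^{−1/δ} exp[−c (p_c − p)^δ n]` for every `0 ≤ p < p_c`
    and `n ≥ 1`.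
  • There exists a constant `C''` such that `E_p[|K|^k] ≤ k! [C''/(p_c − p)]^{(δ−1)+(k−1)δ}` for every `0 ≤ p < p_c` and `k ≥ 1`."

## The specialisation typed here (item = fact ∘ specialisation)

`G = zdGraph d`, the nearest-neighbour graph of `ℤ^d`, `d ≥ 1` (infinite, connected, locally finite, transitive); `K = C(0)`;
`P_p = bondPercolation (zdGraph d) p`; `p_c = criticalProbI d` (`= criticalProb (zdGraph d) 0`, `coe_criticalProbI`); the event
`{|K| ≥ n}` is `clusterSizeGe (0 : Site d) n` (`MeanFieldBetaFromGamma.lean`); the SECOND bullet at `k = 1` only: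
`E_p|K| = χ(p) = chi d p` for `p < p_c` (`SusceptibilityGammaOne.lean`: `chi d p = Σ_x τ_p(0,x)`, `expClusterSize_eq_ofReal_chi`), and
`1! [C''/(p_c−p)]^{δ−1}` is written with `Real.rpow` and `C'' > 0` (a constant satisfying the printed bound for all `p < p_c` can be
taken positive: `χ ≥ 1`).  Hypothesis constant `C` is any real (the printed `C > 0` is implied whenever the hypothesis holds at
`n = 1`).
-- TODO(general form): every infinite connected locally finite transitive graph; all moments `k ≥ 1`
-- (`E_p[|K|^k] ≤ k! [C''/(p_c−p)]^{(δ−1)+(k−1)δ}`); and the first bullet (subcritical volume tail with rate `c (p_c−p)^δ`).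

## References

* T. Hutchcroft, Probab. Math. Phys. 1 (2020) 147–165, arXiv:1901.10363: §1, Theorem 1.1. [Hutchcroft2020]
* M. Aizenman, D. J. Barsky, Comm. Math. Phys. 108 (1987) 489–526 (`δ ≥ 2`, so the hypothesis forces `δ ≥ 2` on `ℤ^d`).
  [AizenmanBarsky1987]
-/

noncomputable section

open MeasureTheory

namespace Literature.Probability.Percolation

open Literature.Probability.LatticeModels

/-- **Hutchcroft 2020, Theorem 1.1, second bullet at `k = 1` (`γ ≤ δ − 1`), bond percolation on `ℤ^d`**: "suppose that there
exist constants `C > 0` and `δ > 1` such that `P_{p_c}(|K| ≥ n) ≤ C n^{−1/δ}` for every `n ≥ 1`. Then … there exists a constant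
`C''` such that `E_p[|K|^k] ≤ k! [C''/(p_c − p)]^{(δ−1)+(k−1)δ}` for every `0 ≤ p < p_c` and `k ≥ 1`" — here `G = ℤ^d` (`d ≥ 1`),
`k = 1`, `E_p|K| = chi d p` (`p < p_c`), `p_c = criticalProbI d`, `C'' > 0`.  No proof is claimed here (printed proof: the OSSS /
two-ghost differential inequality for the volume, §3 of the source); users take `(h : Hutchcroft2020_gamma_le_delta_sub_one)`.
[cite: Hutchcroft2020, Thm. 1.1 (second bullet, k = 1)] -/
def Hutchcroft2020_gamma_le_delta_sub_one : Prop :=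
  ∀ d : ℕ, 1 ≤ d → ∀ C δ : ℝ, 1 < δ →
    (∀ n : ℕ, 1 ≤ n →
      (bondPercolation (zdGraph d) (criticalProbI d)).real (clusterSizeGe (0 : Site d) n) ≤ C * (n : ℝ) ^ (-(1 / δ))) →
    ∃ C'' : ℝ, 0 < C'' ∧ ∀ p : unitInterval, (p : ℝ) < criticalProbI d →
      chi d p ≤ (C'' / ((criticalProbI d : ℝ) - p)) ^ (δ - 1)

end Literature.Probability.Percolation

end
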